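import Mathlib
import HarnessLib
import Literature.MathematicalPhysics.QuantumLattice.GaugeGroups
import Literature.LinearAlgebra.Matrix.SpecialUnitaryGroupConjugacyClasses
import Summits.Ventures.LatticeQCDFlow.Exactness.KernelJacobianChart
import Summits.Ventures.LatticeQCDFlow.Exactness.SpectralCouplingMeasurable

/-!
# The spectral kernel's Jacobian for Haar on `SU(n)`, given the Weyl presentation of Haar by conjugation of the special diagonal torus — the `SU(N)` twin of `SpectralKernelJacobianWeylShape`

HONEST FRAMING: exact (Metropolis-corrected) sampling algorithms for lattice gauge theory;
figures of merit are autocorrelation/cost numbers at stated couplings and volumes; no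
continuum-physics claim.

Venture `LatticeQCDFlow` (cell pub-lqcd), topic `Exactness`; FANOUT row 10 (`eng-equiv`, engine
`latflow.equiv`, `spectral.py` `SUNSpectralCoupling` — the engine's group is `SU(N)`: the box flow
acts on the `N−1` independent eigen-phases of the canonical cell and books the log-det of the
eigenvalue map plus the Haar/Vandermonde factor `log |Δ(f λ)|² − log |Δ(λ)|²`).  NEW WORK of the cell
over `KernelJacobianChart.lean`, `SpectralKernelContinuity.lean` / `SpectralCouplingMeasurable.lean`
and the tree's `Literature/LinearAlgebra/Matrix/{UnitaryGroupMaximalTorus,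
SpecialUnitaryGroupConjugacyClasses}.lean` (the maximal torus `SΔ(n)` of `SU(n)`, compact);
nothing is cited as a fact; no number; no definition is introduced.  Printed counterparts, NAMED
ONLY: Boyda et al., PRD 103 (2021) 074504, eq. (19) and App. A; Weyl's integral formula,
Bröcker–tom Dieck IV (1.11) p. 163 with `G = SU(n)`, `T = SΔ(n)`, `|W| = n!` (IV (3.3)) — entering
as the HYPOTHESIS `hW`, not asserted.

## What is typed (`n` a finite index type; `T = SΔ(n)` with its own Haar probability)

* `coe_specialDiagonalTorus_eq_diagonal`, `norm_specialDiagonalTorus_apply`,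
  `secondCountableTopology_specialDiagonalTorus`, `continuous_conjChart_special` /
  `measurable_conjChart_special` (the chart `(g, t) ↦ g t g⁻¹ : SU(n) × SΔ(n) → SU(n)`),
  `measurable_vandermondeWeight_special` (`t ↦ |Δ(t)|²/n!` on `SΔ(n)`);
* **`spectralKernel_conj_specialDiagonalTorus`** — a kernel `h : SU(n) → SU(n)` following the
  spectral recipe of `f` and a torus map `f_T` with `f_T(diag d) = diag(f d)` satisfy
  `h (g t g⁻¹) = g · f_T t · g⁻¹`;
* **`hasJacobian_spectralKernel_specialUnitaryGroup_of_presentation`** — for any measurable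
  weight `D` on `SΔ(n)` such that conjugation presents `Haar_{SU(n)}` from
  `Haar_{SU(n)} ⊗ D·Haar_{SΔ(n)}` (hypothesis `hW`): `f` continuous on the unimodular torus, `f_T`
  with Jacobian `J_f` for `Haar_{SΔ(n)}`, `J` measurable with `J(g t g⁻¹)·D t = J_f t·D(f_T t)`
  ⟹ `HasJacobian (Haar SU(n)) h J`;
* **`hasJacobian_spectralKernel_specialUnitaryGroup_of_weyl`** — the same with `D = |Δ|²/n!`
  written out (Weyl's formula for `SU(n)` in pushforward form as the hypothesis; Boyda (19)
  cleared of denominators as the identity).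

With `SpectralCouplingMeasurable.hasJacobian_spectralCouplingLayer_of_kernelJacobian` this closes
the engine's `SU(N)` spectral coupling layer's exactness modulo exactly Weyl's formula and the
box flow's torus Jacobian.

NOT here: Weyl's integral formula (hypothesis); that `|Δ(t)| ≠ 0` Haar-a.e.; any number.
-/

noncomputable section

namespace Summit.Ventures.LatticeQCDFlow.Exactness

open MeasureTheory Matrix Topology
open Literature.LinearAlgebra.Matrix
open Literature.MathematicalPhysics.QuantumFieldTheory
open scoped ENNReal

variable {n : Type*} [Fintype n] [DecidableEq n]

/-! ## The diagonal torus and the conjugation chart -/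

/-- An element of `Δ(n)` is the diagonal matrix of its diagonal entries. -/
theorem coe_specialDiagonalTorus_eq_diagonal (t : specialDiagonalTorus n) :
    ((t : Matrix.specialUnitaryGroup n ℂ) : Matrix n n ℂ) =
      diagonal fun i => ((t : Matrix.specialUnitaryGroup n ℂ) : Matrix n n ℂ) i i := by
  obtain ⟨d, hd⟩ := t.2
  rw [hd]
  ext i j
  by_cases hij : i = j
  · subst hij
    rw [diagonal_apply_eq, diagonal_apply_eq, diagonal_apply_eq]
  · rw [diagonal_apply_ne _ hij, diagonal_apply_ne _ hij]

/-- The diagonal entries of `t ∈ Δ(n)` are unimodular. -/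
theorem norm_specialDiagonalTorus_apply (t : specialDiagonalTorus n) (i : n) :
    ‖((t : Matrix.specialUnitaryGroup n ℂ) : Matrix n n ℂ) i i‖ = 1 :=
  (norm_eq_one_and_prod_eq_one_of_mem_specialDiagonalTorus (coe_specialDiagonalTorus_eq_diagonal t)).1 i

/-- `Δ(n)` is second countable (a subspace of `U(n)`). -/
theorem secondCountableTopology_specialDiagonalTorus : SecondCountableTopology (specialDiagonalTorus n) :=
  Topology.IsEmbedding.subtypeVal.secondCountableTopology

/-- **The conjugation chart `(g, t) ↦ g t g⁻¹ : U(n) × Δ(n) → U(n)` is continuous.** -/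
theorem continuous_conjChart_special :
    Continuous fun q : Matrix.specialUnitaryGroup n ℂ × specialDiagonalTorus n =>
      q.1 * (q.2 : Matrix.specialUnitaryGroup n ℂ) * q.1⁻¹ :=
  (continuous_fst.mul (continuous_subtype_val.comp continuous_snd)).mul continuous_fst.inv

/-- **… hence measurable** (Borel structures; both factors second countable). -/
theorem measurable_conjChart_special :
    Measurable fun q : Matrix.specialUnitaryGroup n ℂ × specialDiagonalTorus n =>
      q.1 * (q.2 : Matrix.specialUnitaryGroup n ℂ) * q.1⁻¹ :=
  haveI : SecondCountableTopology (specialDiagonalTorus n) := secondCountableTopology_specialDiagonalTorus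
  continuous_conjChart_special.measurable

/-- **The Vandermonde weight `t ↦ |Δ(t)|²/n! = (∏_i ∏_{j ≠ i} |t_ii − t_jj|)/n!` is measurable on
`Δ(n)`** (continuous). -/
theorem measurable_vandermondeWeight_special :
    Measurable fun t : specialDiagonalTorus n => ENNReal.ofReal
      ((∏ i, ∏ j ∈ Finset.univ.erase i,
        ‖((t : Matrix.specialUnitaryGroup n ℂ) : Matrix n n ℂ) i i -
          ((t : Matrix.specialUnitaryGroup n ℂ) : Matrix n n ℂ) j j‖) / (Fintype.card n).factorial) := by
  have hentry : ∀ i : n, Continuous fun t : specialDiagonalTorus n =>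
      ((t : Matrix.specialUnitaryGroup n ℂ) : Matrix n n ℂ) i i := fun i =>
    ((continuous_apply i).comp ((continuous_apply i).comp
      (continuous_subtype_val.comp continuous_subtype_val)))
  refine (ENNReal.continuous_ofReal.comp ?_).measurable
  exact (continuous_finsetProd _ fun i _ => continuous_finsetProd _ fun j _ =>
    ((hentry i).sub (hentry j)).norm).div_const _

/-! ## The intertwining: the kernel conjugates the torus map -/

/-- **The spectral kernel intertwines conjugation with its torus map**: if `h : U(n) → U(n)`
follows the spectral recipe of `f` and `f_T : Δ(n) → Δ(n)` is `diag(d) ↦ diag(f d)`, then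
`h (g t g⁻¹) = g · f_T t · g⁻¹` for all `g ∈ U(n)`, `t ∈ Δ(n)`. -/
theorem spectralKernel_conj_specialDiagonalTorus {f : (n → ℂ) → (n → ℂ)}
    {h : Matrix.specialUnitaryGroup n ℂ → Matrix.specialUnitaryGroup n ℂ}
    (hagree : ∀ (P : Matrix.specialUnitaryGroup n ℂ) (V : Matrix n n ℂ) (d : n → ℂ),
      V ∈ Matrix.unitaryGroup n ℂ → (P : Matrix n n ℂ) = V * diagonal d * star V →
        ((h P : Matrix.specialUnitaryGroup n ℂ) : Matrix n n ℂ) = V * diagonal (f d) * star V)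
    {fT : specialDiagonalTorus n → specialDiagonalTorus n}
    (hfT : ∀ t : specialDiagonalTorus n, ((fT t : Matrix.specialUnitaryGroup n ℂ) : Matrix n n ℂ) =
      diagonal (f fun i => ((t : Matrix.specialUnitaryGroup n ℂ) : Matrix n n ℂ) i i))
    (g : Matrix.specialUnitaryGroup n ℂ) (t : specialDiagonalTorus n) :
    h (g * (t : Matrix.specialUnitaryGroup n ℂ) * g⁻¹) = g * (fT t : Matrix.specialUnitaryGroup n ℂ) * g⁻¹ := by
  have hmul : ∀ A B : Matrix.specialUnitaryGroup n ℂ,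
      ((A * B : Matrix.specialUnitaryGroup n ℂ) : Matrix n n ℂ) = (A : Matrix n n ℂ) * (B : Matrix n n ℂ) :=
    fun _ _ => rfl
  have hinv : ∀ A : Matrix.specialUnitaryGroup n ℂ,
      ((A⁻¹ : Matrix.specialUnitaryGroup n ℂ) : Matrix n n ℂ) = star (A : Matrix n n ℂ) := fun _ => rfl
  apply Subtype.ext
  have hP : ((g * (t : Matrix.specialUnitaryGroup n ℂ) * g⁻¹ : Matrix.specialUnitaryGroup n ℂ) : Matrix n n ℂ) =
      (g : Matrix n n ℂ) * diagonal (fun i => ((t : Matrix.specialUnitaryGroup n ℂ) : Matrix n n ℂ) i i) *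
        star (g : Matrix n n ℂ) := by
    rw [hmul, hmul, hinv, ← coe_specialDiagonalTorus_eq_diagonal t]
  rw [hagree _ _ _ (Matrix.mem_specialUnitaryGroup_iff.mp g.2).1 hP, hmul, hmul, hinv, hfT t]

/-! ## The Jacobian, given a presentation of Haar by conjugation -/

/-- **The spectral kernel's Jacobian for Haar on `U(n)`, given ANY conjugation presentation.**
Let `D` be a measurable weight on `Δ(n)` such that `(g, t) ↦ g t g⁻¹` pushes
`Haar_{U(n)} ⊗ D·Haar_{Δ(n)}` forward to `Haar_{U(n)}` (`hW`).  Let `f` be continuous on the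
unimodular torus, `h` follow its spectral recipe, `f_T` be its torus map with Jacobian `J_f` for
`Haar_{Δ(n)}`, and `J` be measurable with `J(g t g⁻¹) · D t = J_f t · D (f_T t)`.  Then
`HasJacobian (Haar U(n)) h J`. -/
theorem hasJacobian_spectralKernel_specialUnitaryGroup_of_presentation
    {D : specialDiagonalTorus n → ℝ≥0∞} (hD : Measurable D)
    (hW : Measure.map (fun q : Matrix.specialUnitaryGroup n ℂ × specialDiagonalTorus n =>
        q.1 * (q.2 : Matrix.specialUnitaryGroup n ℂ) * q.1⁻¹)
      ((haarProbability (Matrix.specialUnitaryGroup n ℂ)).prod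
        ((haarProbability (specialDiagonalTorus n)).withDensity D)) =
      haarProbability (Matrix.specialUnitaryGroup n ℂ))
    {f : (n → ℂ) → (n → ℂ)} (hfc : ContinuousOn f {d | ∀ i, ‖d i‖ = 1})
    {h : Matrix.specialUnitaryGroup n ℂ → Matrix.specialUnitaryGroup n ℂ}
    (hagree : ∀ (P : Matrix.specialUnitaryGroup n ℂ) (V : Matrix n n ℂ) (d : n → ℂ),
      V ∈ Matrix.unitaryGroup n ℂ → (P : Matrix n n ℂ) = V * diagonal d * star V →
        ((h P : Matrix.specialUnitaryGroup n ℂ) : Matrix n n ℂ) = V * diagonal (f d) * star V)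
    {fT : specialDiagonalTorus n → specialDiagonalTorus n}
    (hfT : ∀ t : specialDiagonalTorus n, ((fT t : Matrix.specialUnitaryGroup n ℂ) : Matrix n n ℂ) =
      diagonal (f fun i => ((t : Matrix.specialUnitaryGroup n ℂ) : Matrix n n ℂ) i i))
    {Jf : specialDiagonalTorus n → ℝ≥0∞} (hfJ : HasJacobian (haarProbability (specialDiagonalTorus n)) fT Jf)
    {J : Matrix.specialUnitaryGroup n ℂ → ℝ≥0∞} (hJm : Measurable J)
    (hJ : ∀ (g : Matrix.specialUnitaryGroup n ℂ) (t : specialDiagonalTorus n),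
      J (g * (t : Matrix.specialUnitaryGroup n ℂ) * g⁻¹) * D t = Jf t * D (fT t)) :
    HasJacobian (haarProbability (Matrix.specialUnitaryGroup n ℂ)) h J :=
  hasJacobian_of_chart measurable_conjChart_special hD hW hfJ
    (measurable_spectralKernel_specialUnitaryGroup hfc hagree)
    (fun g t => spectralKernel_conj_specialDiagonalTorus hagree hfT g t) hJm (fun q => hJ q)

/-- **The spectral kernel's Jacobian for Haar on `U(n)`, given Weyl's integral formula.**  With
the Vandermonde weight `D(t) = |Δ(t)|²/n! = (∏_i ∏_{j≠i} |t_ii − t_jj|)/n!` the presentation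
hypothesis `hW` reads: conjugation pushes `Haar_{U(n)} ⊗ (|Δ|²/n!)·Haar_{Δ(n)}` forward to
`Haar_{U(n)}` — Weyl's integral formula for `U(n)` (Bröcker–tom Dieck IV (1.11) with `|W| = n!`
and `det(E − Ad(t⁻¹)) = |Δ(t)|²`), in pushforward form, ASSUMED; and the identity for `J` is
Boyda's eq. (19): `J(g t g⁻¹) · |Δ(t)|² = J_f(t) · |Δ(f_T t)|²`.  Conclusion:
`HasJacobian (Haar U(n)) h J` — the kernel with the engine's booked density is an exact transport
of Haar. -/
theorem hasJacobian_spectralKernel_specialUnitaryGroup_of_weyl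
    (hW : Measure.map (fun q : Matrix.specialUnitaryGroup n ℂ × specialDiagonalTorus n =>
        q.1 * (q.2 : Matrix.specialUnitaryGroup n ℂ) * q.1⁻¹)
      ((haarProbability (Matrix.specialUnitaryGroup n ℂ)).prod
        ((haarProbability (specialDiagonalTorus n)).withDensity fun t => ENNReal.ofReal
          ((∏ i, ∏ j ∈ Finset.univ.erase i,
            ‖((t : Matrix.specialUnitaryGroup n ℂ) : Matrix n n ℂ) i i -
              ((t : Matrix.specialUnitaryGroup n ℂ) : Matrix n n ℂ) j j‖) / (Fintype.card n).factorial))) =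
      haarProbability (Matrix.specialUnitaryGroup n ℂ))
    {f : (n → ℂ) → (n → ℂ)} (hfc : ContinuousOn f {d | ∀ i, ‖d i‖ = 1})
    {h : Matrix.specialUnitaryGroup n ℂ → Matrix.specialUnitaryGroup n ℂ}
    (hagree : ∀ (P : Matrix.specialUnitaryGroup n ℂ) (V : Matrix n n ℂ) (d : n → ℂ),
      V ∈ Matrix.unitaryGroup n ℂ → (P : Matrix n n ℂ) = V * diagonal d * star V →
        ((h P : Matrix.specialUnitaryGroup n ℂ) : Matrix n n ℂ) = V * diagonal (f d) * star V)
    {fT : specialDiagonalTorus n → specialDiagonalTorus n}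
    (hfT : ∀ t : specialDiagonalTorus n, ((fT t : Matrix.specialUnitaryGroup n ℂ) : Matrix n n ℂ) =
      diagonal (f fun i => ((t : Matrix.specialUnitaryGroup n ℂ) : Matrix n n ℂ) i i))
    {Jf : specialDiagonalTorus n → ℝ≥0∞} (hfJ : HasJacobian (haarProbability (specialDiagonalTorus n)) fT Jf)
    {J : Matrix.specialUnitaryGroup n ℂ → ℝ≥0∞} (hJm : Measurable J)
    (hJ : ∀ (g : Matrix.specialUnitaryGroup n ℂ) (t : specialDiagonalTorus n),
      J (g * (t : Matrix.specialUnitaryGroup n ℂ) * g⁻¹) * ENNReal.ofReal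
          ((∏ i, ∏ j ∈ Finset.univ.erase i,
            ‖((t : Matrix.specialUnitaryGroup n ℂ) : Matrix n n ℂ) i i -
              ((t : Matrix.specialUnitaryGroup n ℂ) : Matrix n n ℂ) j j‖) / (Fintype.card n).factorial) =
        Jf t * ENNReal.ofReal
          ((∏ i, ∏ j ∈ Finset.univ.erase i,
            ‖((fT t : Matrix.specialUnitaryGroup n ℂ) : Matrix n n ℂ) i i -
              ((fT t : Matrix.specialUnitaryGroup n ℂ) : Matrix n n ℂ) j j‖) / (Fintype.card n).factorial)) :
    HasJacobian (haarProbability (Matrix.specialUnitaryGroup n ℂ)) h J :=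
  hasJacobian_spectralKernel_specialUnitaryGroup_of_presentation measurable_vandermondeWeight_special hW
    hfc hagree hfT hfJ hJm hJ

end Summit.Ventures.LatticeQCDFlow.Exactness
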